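import Summits.KontsevichZagierPeriods.KontsevichZagierPeriods.Theorems.HermiteRigidityReductionRigidityPadeBoxIslandsAllWeights
import Summits.KontsevichZagierPeriods.KontsevichZagierPeriods.Theorems.HermiteRigidityReductionRigidityLineReduction
import Summits.KontsevichZagierPeriods.KontsevichZagierPeriods.Theorems.HermiteRigidityReductionRigidityDupJoinWeightOne
import Summits.KontsevichZagierPeriods.KontsevichZagierPeriods.Theorems.HermiteRigidityReductionRigidityDupJoinScaled
import Summits.KontsevichZagierPeriods.KontsevichZagierPeriods.Theorems.HermiteRigidityReductionRigidityDupJoinValueNeg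
import Summits.KontsevichZagierPeriods.KontsevichZagierPeriods.Theorems.HermiteRigidityDilogRigidity
import Summits.KontsevichZagierPeriods.KontsevichZagierPeriods.Theorems.HermiteRigidityDilogRigidityCubeTwoSeriesLevel
import Literature.NumberTheory.DiophantineApproximation.DilogTwoPointsLinearIndependence
import Summits.KontsevichZagierPeriods.KontsevichZagierPeriods.Theorems.HermiteRigidityReductionRigidityLandenJoinKernel

/-!
# `ReductionRigidity` (stmt-KontsevichZagierPeriods-3407), line `Sketch`: THE DUPLICATION JOIN ISLAND — levels `N`, `−N`, `N²`
# (`stub_dupJoinKernel`), unconditional-minus-DHK for every `N ≥ 10⁸`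

Route `KontsevichZagierPeriods/HermiteRigidity`, crux `ReductionRigidity` (stmt-3407, summit-equivalent; skeleton
`Cruxes/ReductionRigidity/Lines/Sketch.lean` v7). Lead seat c6, cycle 3 (census growth item G9 realised). The route's Padé box
islands (c4/c5) live at ONE level; this file proves a THREE-LEVEL island: on the sector generated by the box generators
`[□ʲ, x^a/(ν − ∏x)^m]` (`j ≤ 2`) at `ν = N`, `ν = −N` and `ν = N²`, the kernel form of Conjecture 1 holds as soon as
`1, Li₁(±1/N), Li₂(±1/N)` are ℚ-linearly independent (`stub_dupJoinKernel`, rigidity inlined); and that is an instance of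
David–Hirata-Kohno–Kawashima 2020, Thm 2.1 for `N ≥ 10⁸` (`dupJoinKernel_large`, over the tree's named fact
`DHK2020_dilogTwoPointsLinearIndependent`). The cross-level content is DUPLICATION in weights one and two (the landed move chains
`stub_dupJoinWeightOne`, `stub_dupJoinScaled`/`stub_boxDuplication`). The normal-form tools
`levelNormalForm`, `integral_cube_zero_level`, `three_carriers_zero` are imported from the Landen join file; `two_carriers_neg` is here.

References: M. Kontsevich, D. Zagier, *Periods* (2001), §1.2 [cite: KontsevichZagier2001, §1.2]; S. David, N. Hirata-Kohno,
M. Kawashima, Moscow J. Comb. Number Theory 9 (2020), Thm 2.1 [cite: DavidHirataKohnoKawashima2020, Thm 2.1]. No definitions are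
introduced.
-/

noncomputable section

open MeasureTheory Set MvPolynomial

namespace Summit.KontsevichZagierPeriods.HermiteRigidity.ReductionRigidity

open Literature.NumberTheory.Transcendental
open Literature.NumberTheory.Transcendental.KZ

section Tools

/-- Two carriers of one additive family with opposite parameters add up to a relation. [cite: KontsevichZagier2001, §1.2 rule (1)] -/
theorem two_carriers_neg {n : ℕ} {D : Set (Fin n → ℝ)} (f : ℚ → (Fin n → ℝ) → ℝ)
    (hf : ∀ β β' x, f (β + β') x = f β x + f β' x) (hf0 : ∀ x, f 0 x = 0)
    (hex : ∀ β : ℚ, ∃ s : IntegralRep n, s.domain = D ∧ EqOn s.integrand (f β) D)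
    {β : ℚ} {s₁ s₂ : IntegralRep n}
    (h₁ : s₁.domain = D) (h₁i : EqOn s₁.integrand (f β) D) (h₂ : s₂.domain = D) (h₂i : EqOn s₂.integrand (f (-β)) D) :
    KZ.of s₁ + KZ.of s₂ ∈ KZ.relations := by
  obtain ⟨u, hu, hui⟩ := hex (β + -β)
  have e := carrier_add f hf h₁ h₁i h₂ h₂i hu hui
  have z : KZ.of u ∈ KZ.relations := carrier_zero f hf0 hu (by rw [add_neg_cancel] at hui; exact hui)
  have : KZ.of s₁ + KZ.of s₂ = KZ.of u - (KZ.of u - KZ.of s₁ - KZ.of s₂) := by abel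
  rw [this]
  exact KZ.relations.sub_mem z e

end Tools

section Assembly

/-- **Registered LEAD stub `stub_dupJoinKernel` — THE DUPLICATION JOIN ISLAND**: for every integer `N ≥ 2`, IF the five numbers
`1, ∫_□ dp/(N−p), ∫_□² dp/(N−pq), ∫_□ dp/((−N)−p), ∫_□² dp/((−N)−pq)` (`= 1, Li₁(1/N), Li₂(1/N), Li₁(−1/N), Li₂(−1/N)`) are
ℚ-linearly independent, THEN Conjecture 1 of Kontsevich–Zagier holds in kernel form on the sector generated by ALL box generators
`[□ʲ, x^a/(ν − ∏x)^m]`, `j ≤ 2`, at the THREE levels `ν = N`, `ν = −N`, `ν = N²`: every `ℤ`-combination of value `0` is a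
chain of moves. Reductions: c4's `genReduction` at each level (`levelNormalForm`); the level `N²` is eliminated by the two
DUPLICATION move chains — weight one `[□¹,1/(N²−p)] ≡ [□¹,1/(N−p)] + [□¹,1/((−N)−p)]` (`stub_dupJoinWeightOne`: chart `p = u²`
+ partial fractions) and weight two `[□²,1/(N²−pq)] ≡ 2[□²,1/(N−pq)] + 2[□²,1/((−N)−pq)]` (`stub_dupJoinScaled`, the landed
`stub_boxDuplication`), each used twice: through soundness for the value relation and as the move that kills the `N²`-part.
[cite: KontsevichZagier2001, §1.2] [cite: DavidHirataKohnoKawashima2020, Thm 2.1] -/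
theorem stub_dupJoinKernel : ∀ (N : ℕ), 2 ≤ N →
    (∀ a b₁ c₁ b₂ c₂ : ℚ, (a : ℝ) + b₁ * (∫ p in cube 1, 1 / ((N : ℝ) - p 0)) +
        c₁ * (∫ p in cube 2, 1 / ((N : ℝ) - p 0 * p 1)) + b₂ * (∫ p in cube 1, 1 / ((-(N : ℝ)) - p 0)) +
        c₂ * (∫ p in cube 2, 1 / ((-(N : ℝ)) - p 0 * p 1)) = 0 →
      a = 0 ∧ b₁ = 0 ∧ c₁ = 0 ∧ b₂ = 0 ∧ c₂ = 0) →
    ∀ c ∈ AddSubgroup.closure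
      ({c | ∃ (j : ℕ) (r : IntegralRep j) (a : Fin j → ℕ) (m : ℕ), j ≤ 2 ∧ r.domain = cube j ∧
          EqOn r.integrand (fun p => (∏ l, p l ^ a l) / ((N : ℝ) - ∏ l, p l) ^ m) (cube j) ∧ c = KZ.of r} ∪
        {c | ∃ (j : ℕ) (r : IntegralRep j) (a : Fin j → ℕ) (m : ℕ), j ≤ 2 ∧ r.domain = cube j ∧
          EqOn r.integrand (fun p => (∏ l, p l ^ a l) / ((-(N : ℝ)) - ∏ l, p l) ^ m) (cube j) ∧ c = KZ.of r} ∪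
        {c | ∃ (j : ℕ) (r : IntegralRep j) (a : Fin j → ℕ) (m : ℕ), j ≤ 2 ∧ r.domain = cube j ∧
          EqOn r.integrand (fun p => (∏ l, p l ^ a l) / ((N : ℝ) ^ 2 - ∏ l, p l) ^ m) (cube j) ∧ c = KZ.of r}),
      KZ.eval c = 0 → c ∈ KZ.relations := by
  intro N hN hrig c hc h0
  have h2Q : (2 : ℚ) ≤ N := by exact_mod_cast hN
  have hν₁ : (1 : ℚ) < N ∨ (N : ℚ) < 0 := natLevel hN
  have hν₂ : (1 : ℚ) < (-(N : ℚ)) ∨ (-(N : ℚ)) < 0 := Or.inr (by linarith)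
  have hν₃ : (1 : ℚ) < ((N : ℚ) ^ 2) ∨ ((N : ℚ) ^ 2) < 0 := Or.inl (by nlinarith)
  have c₁R : ((N : ℚ) : ℝ) = (N : ℝ) := by push_cast; ring
  have c₂R : ((-(N : ℚ) : ℚ) : ℝ) = -(N : ℝ) := by push_cast; ring
  have c₃R : ((((N : ℚ) ^ 2 : ℚ)) : ℝ) = (N : ℝ) ^ 2 := by push_cast; ring
  -- split `c` along the three levels
  rw [AddSubgroup.closure_union, AddSubgroup.closure_union] at hc
  obtain ⟨xy, hxy, z, hz, rfl⟩ := AddSubgroup.mem_sup.1 hc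
  obtain ⟨x, hx, y, hy, rfl⟩ := AddSubgroup.mem_sup.1 hxy
  obtain ⟨α, s, hs, hxs⟩ := levelNormalForm hν₁ 2 x (by
    refine AddSubgroup.closure_mono (fun c hc => ?_) hx
    obtain ⟨j, r, a, m, hj, hr, hri, rfl⟩ := hc
    exact ⟨j, r, a, m, hj, hr, fun p hp => by rw [hri hp, c₁R], rfl⟩)
  obtain ⟨β, t, ht, hyt⟩ := levelNormalForm hν₂ 2 y (by
    refine AddSubgroup.closure_mono (fun c hc => ?_) hy
    obtain ⟨j, r, a, m, hj, hr, hri, rfl⟩ := hc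
    exact ⟨j, r, a, m, hj, hr, fun p hp => by rw [hri hp, c₂R], rfl⟩)
  obtain ⟨γ, u, hu, hzu⟩ := levelNormalForm hν₃ 2 z (by
    refine AddSubgroup.closure_mono (fun c hc => ?_) hz
    obtain ⟨j, r, a, m, hj, hr, hri, rfl⟩ := hc
    exact ⟨j, r, a, m, hj, hr, fun p hp => by rw [hri hp, c₃R], rfl⟩)
  -- unit-parameter duplication triples (for the two value relations)
  obtain ⟨W₁, hW₁, hW₁i⟩ := exists_nfRep (i := 1) hν₃ 1
  obtain ⟨S₁, hS₁, hS₁i⟩ := exists_nfRep (i := 1) hν₁ 1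
  obtain ⟨T₁, hT₁, hT₁i⟩ := exists_nfRep (i := 1) hν₂ 1
  obtain ⟨W₂, hW₂, hW₂i⟩ := exists_nfRep (i := 2) hν₃ 1
  obtain ⟨S₂, hS₂, hS₂i⟩ := exists_nfRep (i := 2) hν₁ (2 * 1)
  obtain ⟨T₂, hT₂, hT₂i⟩ := exists_nfRep (i := 2) hν₂ (2 * 1)
  have hdup1 := stub_dupJoinWeightOne N hN 1 W₁ S₁ T₁ hW₁ (fun p hp => by rw [hW₁i hp]; beta_reduce; push_cast; rw [Fin.prod_univ_one])
    hS₁ (fun p hp => by rw [hS₁i hp]; beta_reduce; push_cast; rw [Fin.prod_univ_one])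
    hT₁ (fun p hp => by rw [hT₁i hp]; beta_reduce; push_cast; rw [Fin.prod_univ_one])
  have hdup2 := stub_dupJoinScaled N hN 1 W₂ S₂ T₂ hW₂ (fun p hp => by rw [hW₂i hp]; beta_reduce; push_cast; rw [Fin.prod_univ_two])
    hS₂ (fun p hp => by rw [hS₂i hp]; beta_reduce; push_cast; rw [Fin.prod_univ_two])
    hT₂ (fun p hp => by rw [hT₂i hp]; beta_reduce; push_cast; rw [Fin.prod_univ_two])
  -- VALUES: rewrite the generic integrals in the statement's shapes
  have I0 : ∀ ν : ℚ, (∫ p in cube 0, 1 / ((ν : ℝ) - ∏ l, p l)) = 1 / ((ν : ℝ) - 1) := integral_cube_zero_level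
  have I1 : ∀ ν : ℚ, (∫ p in cube 1, 1 / ((ν : ℝ) - ∏ l, p l)) = ∫ p in cube 1, 1 / ((ν : ℝ) - p 0) := fun ν =>
    setIntegral_congr_fun measurableSet_cube fun p _ => by rw [Fin.prod_univ_one]
  have I2 : ∀ ν : ℚ, (∫ p in cube 2, 1 / ((ν : ℝ) - ∏ l, p l)) = ∫ p in cube 2, 1 / ((ν : ℝ) - p 0 * p 1) := fun ν =>
    setIntegral_congr_fun measurableSet_cube fun p _ => by rw [Fin.prod_univ_two]
  -- the two duplication VALUE relations (soundness of the move chains)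
  have hV1 : (∫ p in cube 1, 1 / ((N : ℝ) ^ 2 - p 0)) - (∫ p in cube 1, 1 / ((N : ℝ) - p 0)) -
      (∫ p in cube 1, 1 / ((-(N : ℝ)) - p 0)) = 0 := by
    have h := eval_eq_zero_of_mem_relations hdup1
    rw [map_sub, map_sub, eval_nfRep hW₁ hW₁i, eval_nfRep hS₁ hS₁i, eval_nfRep hT₁ hT₁i, I1, I1, I1, c₁R, c₂R, c₃R] at h
    push_cast at h
    linarith
  have hV2 : (∫ p in cube 2, 1 / ((N : ℝ) ^ 2 - p 0 * p 1)) - 2 * (∫ p in cube 2, 1 / ((N : ℝ) - p 0 * p 1)) -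
      2 * (∫ p in cube 2, 1 / ((-(N : ℝ)) - p 0 * p 1)) = 0 := by
    have h := eval_eq_zero_of_mem_relations hdup2
    rw [map_sub, map_sub, eval_nfRep hW₂ hW₂i, eval_nfRep hS₂ hS₂i, eval_nfRep hT₂ hT₂i, I2, I2, I2, c₁R, c₂R, c₃R] at h
    push_cast at h
    linarith
  -- the value of `c`
  have hsum3 : ∀ (v : (i : ℕ) → IntegralRep i), ∑ i ∈ Finset.range 3, KZ.of (v i) = KZ.of (v 0) + KZ.of (v 1) + KZ.of (v 2) := by
    intro v
    rw [Finset.sum_range_succ, Finset.sum_range_succ, Finset.sum_range_one]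
  rw [hsum3] at hxs hyt hzu
  have hval : ((α 0 / ((N : ℚ) - 1) + β 0 / (-(N : ℚ) - 1) + γ 0 / ((N : ℚ) ^ 2 - 1) : ℚ) : ℝ) +
      ((α 1 + γ 1 : ℚ) : ℝ) * (∫ p in cube 1, 1 / ((N : ℝ) - p 0)) +
      ((α 2 + 2 * γ 2 : ℚ) : ℝ) * (∫ p in cube 2, 1 / ((N : ℝ) - p 0 * p 1)) +
      ((β 1 + γ 1 : ℚ) : ℝ) * (∫ p in cube 1, 1 / ((-(N : ℝ)) - p 0)) +
      ((β 2 + 2 * γ 2 : ℚ) : ℝ) * (∫ p in cube 2, 1 / ((-(N : ℝ)) - p 0 * p 1)) = 0 := by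
    have ex := eval_eq_zero_of_mem_relations hxs
    have ey := eval_eq_zero_of_mem_relations hyt
    have ez := eval_eq_zero_of_mem_relations hzu
    rw [map_sub, map_add, map_add, eval_nfRep (hs 0).1 (hs 0).2, eval_nfRep (hs 1).1 (hs 1).2,
      eval_nfRep (hs 2).1 (hs 2).2, I0, I1, I2, c₁R] at ex
    rw [map_sub, map_add, map_add, eval_nfRep (ht 0).1 (ht 0).2, eval_nfRep (ht 1).1 (ht 1).2,
      eval_nfRep (ht 2).1 (ht 2).2, I0, I1, I2, c₂R] at ey
    rw [map_sub, map_add, map_add, eval_nfRep (hu 0).1 (hu 0).2, eval_nfRep (hu 1).1 (hu 1).2,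
      eval_nfRep (hu 2).1 (hu 2).2, I0, I1, I2, c₃R] at ez
    rw [map_add, map_add] at h0
    push_cast
    linear_combination h0 - ex - ey - ez - (γ 1 : ℝ) * hV1 - (γ 2 : ℝ) * hV2
  obtain ⟨hA, hB₁, hC₁, hB₂, hC₂⟩ := hrig _ _ _ _ _ hval
  have hB₁' : α 1 = -γ 1 := by linarith
  have hB₂' : β 1 = -γ 1 := by linarith
  have hC₁' : α 2 = -(2 * γ 2) := by linarith
  have hC₂' : β 2 = -(2 * γ 2) := by linarith
  have hN1 : (2 : ℝ) ≤ N := by exact_mod_cast hN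
  -- weight two: the scaled duplication chain kills `u 2 + s 2 + t 2`
  obtain ⟨sP, hsP, hsPi⟩ := exists_nfRep (i := 2) hν₁ (2 * γ 2)
  obtain ⟨tP, htP, htPi⟩ := exists_nfRep (i := 2) hν₂ (2 * γ 2)
  have h2a : KZ.of (u 2) - KZ.of sP - KZ.of tP ∈ KZ.relations :=
    stub_dupJoinScaled N hN (γ 2) (u 2) sP tP (hu 2).1 (fun p hp => by rw [(hu 2).2 hp]; beta_reduce; push_cast; rw [Fin.prod_univ_two])
      hsP (fun p hp => by rw [hsPi hp]; beta_reduce; push_cast; rw [Fin.prod_univ_two])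
      htP (fun p hp => by rw [htPi hp]; beta_reduce; push_cast; rw [Fin.prod_univ_two])
  have h2b : KZ.of sP + KZ.of (s 2) ∈ KZ.relations :=
    two_carriers_neg (D := cube 2) (fun b p => (b : ℝ) / ((N : ℝ) - p 0 * p 1)) (fun b b' p => by push_cast; ring)
      (fun p => by simp) (fun b => by
        obtain ⟨r, hr, hri⟩ := exists_nfRep (i := 2) hν₁ b
        exact ⟨r, hr, fun p hp => by rw [hri hp]; beta_reduce; rw [c₁R, Fin.prod_univ_two]⟩) (β := 2 * γ 2)
      hsP (fun p hp => by rw [hsPi hp]; beta_reduce; rw [c₁R, Fin.prod_univ_two]) (hs 2).1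
      (fun p hp => by rw [(hs 2).2 hp, hC₁']; beta_reduce; rw [c₁R, Fin.prod_univ_two])
  have h2c : KZ.of tP + KZ.of (t 2) ∈ KZ.relations :=
    two_carriers_neg (D := cube 2) (fun b p => (b : ℝ) / ((-(N : ℝ)) - p 0 * p 1)) (fun b b' p => by push_cast; ring)
      (fun p => by simp) (fun b => by
        obtain ⟨r, hr, hri⟩ := exists_nfRep (i := 2) hν₂ b
        exact ⟨r, hr, fun p hp => by rw [hri hp]; beta_reduce; rw [c₂R, Fin.prod_univ_two]⟩) (β := 2 * γ 2)
      htP (fun p hp => by rw [htPi hp]; beta_reduce; rw [c₂R, Fin.prod_univ_two]) (ht 2).1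
      (fun p hp => by rw [(ht 2).2 hp, hC₂']; beta_reduce; rw [c₂R, Fin.prod_univ_two])
  -- weight one: the weight-one duplication kills `u 1 + s 1 + t 1`
  obtain ⟨sL, hsL, hsLi⟩ := exists_nfRep (i := 1) hν₁ (γ 1)
  obtain ⟨tL, htL, htLi⟩ := exists_nfRep (i := 1) hν₂ (γ 1)
  have h1a : KZ.of (u 1) - KZ.of sL - KZ.of tL ∈ KZ.relations :=
    stub_dupJoinWeightOne N hN (γ 1) (u 1) sL tL (hu 1).1 (fun p hp => by rw [(hu 1).2 hp]; beta_reduce; push_cast; rw [Fin.prod_univ_one])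
      hsL (fun p hp => by rw [hsLi hp]; beta_reduce; push_cast; rw [Fin.prod_univ_one])
      htL (fun p hp => by rw [htLi hp]; beta_reduce; push_cast; rw [Fin.prod_univ_one])
  have h1b : KZ.of sL + KZ.of (s 1) ∈ KZ.relations :=
    two_carriers_neg (D := cube 1) (fun b p => (b : ℝ) / ((N : ℝ) - p 0)) (fun b b' p => by push_cast; ring)
      (fun p => by simp) (fun b => by
        obtain ⟨r, hr, hri⟩ := exists_nfRep (i := 1) hν₁ b
        exact ⟨r, hr, fun p hp => by rw [hri hp]; beta_reduce; rw [c₁R, Fin.prod_univ_one]⟩) (β := γ 1)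
      hsL (fun p hp => by rw [hsLi hp]; beta_reduce; rw [c₁R, Fin.prod_univ_one]) (hs 1).1
      (fun p hp => by rw [(hs 1).2 hp, hB₁']; beta_reduce; rw [c₁R, Fin.prod_univ_one])
  have h1c : KZ.of tL + KZ.of (t 1) ∈ KZ.relations :=
    two_carriers_neg (D := cube 1) (fun b p => (b : ℝ) / ((-(N : ℝ)) - p 0)) (fun b b' p => by push_cast; ring)
      (fun p => by simp) (fun b => by
        obtain ⟨r, hr, hri⟩ := exists_nfRep (i := 1) hν₂ b
        exact ⟨r, hr, fun p hp => by rw [hri hp]; beta_reduce; rw [c₂R, Fin.prod_univ_one]⟩) (β := γ 1)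
      htL (fun p hp => by rw [htLi hp]; beta_reduce; rw [c₂R, Fin.prod_univ_one]) (ht 1).1
      (fun p hp => by rw [(ht 1).2 hp, hB₂']; beta_reduce; rw [c₂R, Fin.prod_univ_one])
  -- weight zero: three constants summing to `0`
  have h0' : KZ.of (s 0) + KZ.of (t 0) + KZ.of (u 0) ∈ KZ.relations := by
    refine three_carriers_zero (D := cube 0) (fun b _ => (b : ℝ)) (fun b b' p => by push_cast; ring)
      (fun p => by simp) (fun b => exists_nf0 b) (β₁ := α 0 / ((N : ℚ) - 1)) (β₂ := β 0 / (-(N : ℚ) - 1))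
      (β₃ := γ 0 / ((N : ℚ) ^ 2 - 1)) hA (hs 0).1 (fun p hp => ?_) (ht 0).1 (fun p hp => ?_) (hu 0).1 (fun p hp => ?_)
    · rw [(hs 0).2 hp]; simp [Finset.univ_eq_empty]
    · rw [(ht 0).2 hp]; simp [Finset.univ_eq_empty]
    · rw [(hu 0).2 hp]; simp [Finset.univ_eq_empty]
  have : x + y + z = (x - (KZ.of (s 0) + KZ.of (s 1) + KZ.of (s 2))) + (y - (KZ.of (t 0) + KZ.of (t 1) + KZ.of (t 2))) +
      (z - (KZ.of (u 0) + KZ.of (u 1) + KZ.of (u 2))) +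
      ((KZ.of (u 2) - KZ.of sP - KZ.of tP) + (KZ.of sP + KZ.of (s 2)) + (KZ.of tP + KZ.of (t 2))) +
      ((KZ.of (u 1) - KZ.of sL - KZ.of tL) + (KZ.of sL + KZ.of (s 1)) + (KZ.of tL + KZ.of (t 1))) +
      (KZ.of (s 0) + KZ.of (t 0) + KZ.of (u 0)) := by abel
  rw [this]
  refine KZ.relations.add_mem (KZ.relations.add_mem (KZ.relations.add_mem (KZ.relations.add_mem
    (KZ.relations.add_mem hxs hyt) hzu) (KZ.relations.add_mem (KZ.relations.add_mem h2a h2b) h2c))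
    (KZ.relations.add_mem (KZ.relations.add_mem h1a h1b) h1c)) h0'

/-- **THE DUPLICATION JOIN ISLAND FOR EVERY `N ≥ 10⁸`, over David–Hirata-Kohno–Kawashima 2020** (the tree's named fact
`DHK2020_dilogTwoPointsLinearIndependent`): Conjecture 1 in kernel form on the three-level box sector `{N, −N, N²}`. The four
normal-form values are the series by `stub_cubeOneIntegralSeries`, `stub_cubeTwoIntegralSeriesLevel` (c5) and
`stub_dupJoinValueNegOne/Two`. A CONDITIONAL result (named-fact hypothesis). [cite: DavidHirataKohnoKawashima2020, Thm 2.1]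
[cite: KontsevichZagier2001, §1.2] -/
theorem dupJoinKernel_large
    (hDHK : Literature.NumberTheory.DiophantineApproximation.DHK2020_dilogTwoPointsLinearIndependent) :
    ∀ (N : ℕ), 10 ^ 8 ≤ N → ∀ c ∈ AddSubgroup.closure
      ({c | ∃ (j : ℕ) (r : IntegralRep j) (a : Fin j → ℕ) (m : ℕ), j ≤ 2 ∧ r.domain = cube j ∧
          EqOn r.integrand (fun p => (∏ l, p l ^ a l) / ((N : ℝ) - ∏ l, p l) ^ m) (cube j) ∧ c = KZ.of r} ∪
        {c | ∃ (j : ℕ) (r : IntegralRep j) (a : Fin j → ℕ) (m : ℕ), j ≤ 2 ∧ r.domain = cube j ∧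
          EqOn r.integrand (fun p => (∏ l, p l ^ a l) / ((-(N : ℝ)) - ∏ l, p l) ^ m) (cube j) ∧ c = KZ.of r} ∪
        {c | ∃ (j : ℕ) (r : IntegralRep j) (a : Fin j → ℕ) (m : ℕ), j ≤ 2 ∧ r.domain = cube j ∧
          EqOn r.integrand (fun p => (∏ l, p l ^ a l) / ((N : ℝ) ^ 2 - ∏ l, p l) ^ m) (cube j) ∧ c = KZ.of r}),
      KZ.eval c = 0 → c ∈ KZ.relations := by
  intro N hN
  have hN2 : 2 ≤ N := le_trans (by norm_num) hN
  refine stub_dupJoinKernel N hN2 fun a b₁ c₁ b₂ c₂ h => ?_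
  have hNR : (2 : ℝ) ≤ N := by exact_mod_cast hN2
  have I1 : (∫ p in cube 1, 1 / ((N : ℝ) - p 0)) =
      Literature.NumberTheory.DiophantineApproximation.DilogPade.polylogSeries 1 (1 / (N : ℝ)) := by
    rw [stub_cubeOneIntegralSeries N hN2, Literature.NumberTheory.DiophantineApproximation.DilogPade.polylogSeries]
    exact tsum_congr fun k => by rw [pow_one]
  have I2 : (∫ p in cube 2, 1 / ((N : ℝ) - p 0 * p 1)) =
      Literature.NumberTheory.DiophantineApproximation.DilogPade.polylogSeries 2 (1 / (N : ℝ)) := by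
    rw [stub_cubeTwoIntegralSeriesLevel (N : ℝ) hNR, Literature.NumberTheory.DiophantineApproximation.DilogPade.polylogSeries]
  have I1' : (∫ p in cube 1, 1 / ((-(N : ℝ)) - p 0)) =
      Literature.NumberTheory.DiophantineApproximation.DilogPade.polylogSeries 1 (-(1 / (N : ℝ))) := by
    rw [stub_dupJoinValueNegOne N hN2, Literature.NumberTheory.DiophantineApproximation.DilogPade.polylogSeries]
    exact tsum_congr fun k => by rw [pow_one]
  have I2' : (∫ p in cube 2, 1 / ((-(N : ℝ)) - p 0 * p 1)) =
      Literature.NumberTheory.DiophantineApproximation.DilogPade.polylogSeries 2 (-(1 / (N : ℝ))) := by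
    rw [stub_dupJoinValueNegTwo N hN2, Literature.NumberTheory.DiophantineApproximation.DilogPade.polylogSeries]
  rw [I1, I2, I1', I2'] at h
  exact hDHK N hN a b₁ c₁ b₂ c₂ h

end Assembly

end Summit.KontsevichZagierPeriods.HermiteRigidity.ReductionRigidity

end
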